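import Literature.MathematicalPhysics.QuantumFieldTheory.Balaban1983to89.B9Eq3104CutoffCommutatorSizes

/-!
# `Balaban1983to89.B9Eq3104CommutatorSizesAvg` — T. Bałaban, *Propagators for lattice gauge theories in a background field*,
# Commun. Math. Phys. **99** (1985) 389–434 [Balaban1985BackgroundPropagators], Sect. C (3.102) p. 414 («[Q_j(U), h]A(c) = (S_j(∂h)R_{U,c}A)(c) with an
# averaging operation S_j having the same properties as Q_j») and p. 409 («K(h_□) … satisfies the inequality (3.89)»): THE PRINT-SHAPE SIZE OF THE
# AVERAGING PIECE `[h_□, Q*(U)aQ(U)]` OF `K(h_□)(U) = [h_□, Δ_loc(U)]` AT THE COVER OF RECORD (module M5.7-est, file D′₃a)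

statement-level skeleton of published theorems with citation tags; proofs where landed; nothing here is a claim about the Yang–Mills mass gap

THE PIECE.  By this seat's `B9Eq3104CutoffCommutators.cutCommR_QsY_aY_QY`: `[h_□](Q*aQ) = ([h_□]Q*)∘a∘Q + Q*∘a∘([h_□]Q)` (the diagonal `a` commutes with the
coarse cut-off `hIbY`), and each averaging commutator is `S_j(∂h)`-small: its kernel entries carry `h_□(b₋) − h_□(corner of y)` with `Q*(b,y) ≠ 0` ∕
`Q(y,f) ≠ 0`, of size `≤ θ_Q = sLipT∕(L·M_h)·(L+3)` (this seat's `abs_hBdY_sub_hIbY_le_of_qsK_ne_zero` ∕ `abs_hIbY_sub_hBdY_le_of_qK_ne_zero`).  The weights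
`a = diag(w)` (def-Y's `aK_eq_diagonal`) are paired with the values of `A`: the hypothesis is the LEVEL-FREE product bound `w_y·‖A(f)‖ ≤ P` on the
double blocks (`w_y ~ L^{−2j}c_f²` against `‖A‖ ~ B₀L^{2j}∕c_f²` in file E′).

## WHAT THIS FILE PROVES (THEOREMS only; 0 definitions, 0 `def … : Prop`, 0 sorry)
* `aY_apply` — `(aY X)(y) = w_y•X(y)`; `sum_abs_qK_eq_one` — `Σ_f|Q(y,f)| = 1`; `mul_norm_QY_apply_le` — `w_y‖(Q(U)A)(y)‖ ≤ P` from the product bound (p21՚s `sum_qwt_eq_one`, `qwt_nonneg`).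
* `norm_QsY_apply_le` — `‖(Q*(U)X)(b)‖ ≤ Σ_y|Q*(b,y)|·sup‖X‖` on the support.
* ★★ `norm_cutCommR_QsY_aY_QY_hTY_apply_le` — **THE AVERAGING PIECE IN PRINT'S SHAPE**: for bi-contractive contour transporters `qT` and the product
  bound `P`: `‖([h_□](Q*_UaQ_U))A(b)‖ ≤ 2·θ_Q·P·Σ_y|Q*(b,y)|` — «S_j(∂h) … the same properties as Q_j», O(M⁻¹) uniformly in the level.
HONEST SCOPE.  The column sum `Σ_y|Q*(b,y)|` is left symbolic (a combinatorial constant of p21's weights `qwt`, supplied in file E′ or by its owner);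
nothing of Thm 3.10 ∕ 3.3 asserted; YM mass gap NOT proved by any of this (Track A conditional rung).  `--supports stmt-QuantumFields-19200`.
Net new unproved facts: 0.
-/

noncomputable section

namespace Literature.MathematicalPhysics.QuantumFieldTheory.Balaban1983to89.B9Eq3104CommutatorSizesAvg

open Node00
open B9Thm37CubeCoverCommutators (cutMulY cutMulY_apply hTY hTY_apply)
open B9Thm37CubeCoverCommutatorSizes (side_conditions)
open B9Eq3104CutoffCommutators (cutCommR cutCommR_apply hBdY hIbY cutCommR_QsY_aY_QY norm_trLiftY_apply_le norm_cutCommR_trLiftY_apply_le_of_bound)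
open B9Eq3104CutoffCommutatorSizes (abs_hIbY_sub_hBdY_le_of_qK_ne_zero abs_hBdY_sub_hIbY_le_of_qsK_ne_zero norm_cutCommR_QY_hTY_apply_le)
open B6KLevelCensusIndexV1 (KIdx)
open B6Cover236MultiLevelBlocks (cubes)
open B6Partition118KLevelTorusBinders (sLipT sLipT_nonneg)
open B9Eq3132Ineq2142Covariant (qK_apply sum_qwt_eq_one)
open B6Ineq2142KLevelV1 (qwt_nonneg)
open B9Eq39Adjoint (R R_smul)
open B9Eq310Hermitian (norm_R_le)
open scoped Matrix

variable {𝔸 : Type} [NormedRing 𝔸] [NormedAlgebra ℂ 𝔸] [CompleteSpace 𝔸]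
variable {d ℓ : ℕ} {hd : 1 ≤ d + 1} {hL : Odd (ℓ + 1) ∧ 1 < ℓ + 1} {b₀ b₁ : ℝ}
variable (i : KIdx d ℓ hd hL b₀ b₁)

/-! ## §1 The weights and the averaging, read -/

omit [CompleteSpace 𝔸] in
/-- `(aY X)(y) = w_y•X(y)` (def-Y's `aK = diag(w)`). [cite: Balaban1985BackgroundPropagators, (3.25) p.395] -/
theorem aY_apply (X : IBondY i → 𝔸) (y : IBondY i) : aY (𝔸 := 𝔸) i X y = ((i.w y : ℝ) : ℂ) • X y := by
  classical
  show liftMatY 𝔸 (aK i) X y = _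
  rw [aK_eq_diagonal, liftMatY_apply, Finset.sum_eq_single y]
  · rw [Matrix.diagonal_apply_eq]
  · intro y' _ hne; rw [Matrix.diagonal_apply_ne _ (Ne.symm hne), Complex.ofReal_zero, zero_smul]
  · intro h; exact absurd (Finset.mem_univ y) h

/-- `Q ≥ 0` with unit row sums: `Σ_f |Q(y,f)| = 1`. [cite: Balaban1985BackgroundPropagators, (3.12)–(3.14) p.393; Balaban1984PropagatorsI, (1.18) p.20] -/
theorem sum_abs_qK_eq_one (y : IBondY i) : ∑ f, |qK i y f| = 1 := by
  rw [← sum_qwt_eq_one i y]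
  refine Finset.sum_congr rfl fun f _ => ?_
  rw [qK_apply, abs_of_nonneg (qwt_nonneg _ _ _ _ _)]

/-- **the weighted size of one average**: `w_y·‖A(f)‖ ≤ P` on the support of `Q(y,·)` ⇒ `w_y·‖(Q(U)A)(y)‖ ≤ P`.
[cite: Balaban1985BackgroundPropagators, (3.12)–(3.14) p.393, (3.25) p.395] -/
theorem mul_norm_QY_apply_le (parB : BondParY 𝔸 i) (U : CfgY 𝔸 i)
    (hT : ∀ (y : IBondY i) (f : FBondY i), ‖(qT i parB U y f : 𝔸)‖ ≤ 1 ∧ ‖(((qT i parB U y f)⁻¹ : 𝔸ˣ) : 𝔸)‖ ≤ 1)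
    (A : FBondY i → 𝔸) (y : IBondY i) {P : ℝ} (hA : ∀ f, qK i y f ≠ 0 → i.w y * ‖A f‖ ≤ P) :
    i.w y * ‖QY i parB U A y‖ ≤ P := by
  have hw : 0 ≤ i.w y := le_of_lt (i.hw y)
  have e : ‖QY i parB U A y‖ ≤ ∑ f, |qK i y f| * ‖A f‖ := norm_trLiftY_apply_le (qK i) hT A y
  calc i.w y * ‖QY i parB U A y‖ ≤ i.w y * ∑ f, |qK i y f| * ‖A f‖ := mul_le_mul_of_nonneg_left e hw
    _ = ∑ f, |qK i y f| * (i.w y * ‖A f‖) := by rw [Finset.mul_sum]; exact Finset.sum_congr rfl fun f _ => by ring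
    _ ≤ ∑ f, |qK i y f| * P := by
        refine Finset.sum_le_sum fun f _ => ?_
        by_cases hq : qK i y f = 0
        · rw [hq, abs_zero, zero_mul, zero_mul]
        · exact mul_le_mul_of_nonneg_left (hA f hq) (abs_nonneg _)
    _ = P := by rw [← Finset.sum_mul, sum_abs_qK_eq_one, one_mul]

/-- the adjoint averaging, sized on the support: `‖(Q*(U)X)(b)‖ ≤ (Σ_y|Q*(b,y)|)·B` for `‖X(y)‖ ≤ B` whenever `Q*(b,y) ≠ 0`.
[cite: Balaban1985BackgroundPropagators, (3.14) p.393 («Q*»)] -/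
theorem norm_QsY_apply_le (parB : BondParY 𝔸 i) (U : CfgY 𝔸 i)
    (hT : ∀ (y : IBondY i) (f : FBondY i), ‖(qT i parB U y f : 𝔸)‖ ≤ 1 ∧ ‖(((qT i parB U y f)⁻¹ : 𝔸ˣ) : 𝔸)‖ ≤ 1)
    (X : IBondY i → 𝔸) (b : FBondY i) {B : ℝ} (hX : ∀ y, qsK i b y ≠ 0 → ‖X y‖ ≤ B) :
    ‖QsY i parB U X b‖ ≤ (∑ y, |qsK i b y|) * B := by
  have hT' : ∀ (b : FBondY i) (y : IBondY i), ‖(((qT i parB U y b)⁻¹ : 𝔸ˣ) : 𝔸)‖ ≤ 1 ∧ ‖((((qT i parB U y b)⁻¹)⁻¹ : 𝔸ˣ) : 𝔸)‖ ≤ 1 :=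
    fun b y => ⟨(hT y b).2, by rw [inv_inv]; exact (hT y b).1⟩
  have e : ‖QsY i parB U X b‖ ≤ ∑ y, |qsK i b y| * ‖X y‖ := norm_trLiftY_apply_le (qsK i) hT' X b
  refine e.trans ?_
  rw [Finset.sum_mul]
  refine Finset.sum_le_sum fun y _ => ?_
  by_cases hq : qsK i b y = 0
  · rw [hq, abs_zero, zero_mul, zero_mul]
  · exact mul_le_mul_of_nonneg_left (hX y hq) (abs_nonneg _)

/-! ## §2 The averaging piece of `K(h_□)(U)` in print's shape -/

/-- ★★ **THE AVERAGING PIECE `[h_□, Q*_Ua Q_U]` OF `K(h_□)(U)` IN PRINT'S SHAPE — (3.102) p. 414 ∕ p. 409.**  For bi-contractive contour transporters and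
the level-free product bound `w_y·‖A(f)‖ ≤ P` on the double blocks met (`Q*(b,y) ≠ 0`, `Q(y,f) ≠ 0`):
`‖([h_□](Q*_U a Q_U))A(b)‖ ≤ 2·θ_Q·P·Σ_y|Q*(b,y)|`, `θ_Q = sLipT∕(L·M_h)·(L+3)` — both averaging commutators are `S_j(∂h)`-small («an averaging operation
S_j having the same properties as Q_j»), O(M⁻¹) uniformly in the level. [cite: Balaban1985BackgroundPropagators, (3.102) p.414, (3.89) p.409, (3.25) p.395] -/
theorem norm_cutCommR_QsY_aY_QY_hTY_apply_le (c : ↥(cubes i.D.toDomains)) (parB : BondParY 𝔸 i) (U : CfgY 𝔸 i)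
    (hT : ∀ (y : IBondY i) (f : FBondY i), ‖(qT i parB U y f : 𝔸)‖ ≤ 1 ∧ ‖(((qT i parB U y f)⁻¹ : 𝔸ˣ) : 𝔸)‖ ≤ 1)
    (A : FBondY i → 𝔸) (b : FBondY i) {P : ℝ}
    (hA : ∀ (y : IBondY i) (f : FBondY i), qsK i b y ≠ 0 → qK i y f ≠ 0 → i.w y * ‖A f‖ ≤ P) :
    ‖cutCommR (hBdY i (hTY i c)) (hBdY i (hTY i c)) (QsY i parB U ∘ₗ aY i ∘ₗ QY i parB U) A b‖
      ≤ 2 * (sLipT d ℓ / (((ℓ : ℝ) + 1) * i.Mh) * (((ℓ : ℝ) + 1) + 3)) * P * ∑ y, |qsK i b y| := by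
  obtain ⟨_, hMh, _, _⟩ := side_conditions i
  have hM : (0 : ℝ) < i.Mh := by exact_mod_cast (lt_of_lt_of_le (by norm_num) hMh)
  have hθ : 0 ≤ sLipT d ℓ / (((ℓ : ℝ) + 1) * i.Mh) * (((ℓ : ℝ) + 1) + 3) := mul_nonneg (div_nonneg (sLipT_nonneg d ℓ) (by positivity)) (by positivity)
  have hT' : ∀ (b : FBondY i) (y : IBondY i), ‖(((qT i parB U y b)⁻¹ : 𝔸ˣ) : 𝔸)‖ ≤ 1 ∧ ‖((((qT i parB U y b)⁻¹)⁻¹ : 𝔸ˣ) : 𝔸)‖ ≤ 1 :=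
    fun b y => ⟨(hT y b).2, by rw [inv_inv]; exact (hT y b).1⟩
  rw [cutCommR_QsY_aY_QY, LinearMap.add_apply, Pi.add_apply, LinearMap.comp_apply, LinearMap.comp_apply, LinearMap.comp_apply, LinearMap.comp_apply]
  -- first term: `([h]Q*)(a Q A)(b)`, values `w_y (Q A)(y)` of size `≤ P`
  have h1 : ‖cutCommR (hBdY i (hTY i c)) (hIbY i (hTY i c)) (QsY i parB U) (aY i (QY i parB U A)) b‖
      ≤ sLipT d ℓ / (((ℓ : ℝ) + 1) * i.Mh) * (((ℓ : ℝ) + 1) + 3) * P * ∑ y, |qsK i b y| := by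
    refine norm_cutCommR_trLiftY_apply_le_of_bound _ _ (qsK i) hT' _ b hθ (fun y hy => abs_hBdY_sub_hIbY_le_of_qsK_ne_zero i c hy) ?_
    intro y hy
    rw [aY_apply, norm_smul, Complex.norm_real, Real.norm_eq_abs, abs_of_pos (i.hw y)]
    exact mul_norm_QY_apply_le i parB U hT A y (fun f hf => hA y f hy hf)
  -- second term: `Q* a ([h]Q A)(b)`, values `w_y ([h]Q A)(y)` of size `≤ θ_Q P`
  have h2 : ‖QsY i parB U (aY i (cutCommR (hIbY i (hTY i c)) (hBdY i (hTY i c)) (QY i parB U) A)) b‖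
      ≤ (∑ y, |qsK i b y|) * (sLipT d ℓ / (((ℓ : ℝ) + 1) * i.Mh) * (((ℓ : ℝ) + 1) + 3) * P) := by
    refine norm_QsY_apply_le i parB U hT _ b fun y hy => ?_
    rw [aY_apply, norm_smul, Complex.norm_real, Real.norm_eq_abs, abs_of_pos (i.hw y)]
    have hw : 0 < i.w y := i.hw y
    -- `w_y ‖[h]Q A (y)‖ ≤ θ_Q (w_y B_y) Σ|Q| = θ_Q P`, with `B_y = P / w_y`
    have e := norm_cutCommR_QY_hTY_apply_le i c parB U hT A y (B := P / i.w y) fun f hf => by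
      rw [le_div_iff₀ hw, mul_comm]; exact hA y f hy hf
    rw [sum_abs_qK_eq_one, mul_one] at e
    calc i.w y * ‖cutCommR (hIbY i (hTY i c)) (hBdY i (hTY i c)) (QY i parB U) A y‖
        ≤ i.w y * (sLipT d ℓ / (((ℓ : ℝ) + 1) * i.Mh) * (((ℓ : ℝ) + 1) + 3) * (P / i.w y)) := mul_le_mul_of_nonneg_left e (le_of_lt hw)
      _ = _ := by field_simp
  have s := (norm_add_le _ _).trans (add_le_add h1 h2)
  refine s.trans (le_of_eq ?_)
  ring

end Literature.MathematicalPhysics.QuantumFieldTheory.Balaban1983to89.B9Eq3104CommutatorSizesAvg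

end
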